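import Summits.PneNP.PneNP.Theorems.ResolutionCannotProvePrimality.Negative.CornerPrimesRows

/-!
# Corner primes III — the whole corner refutation, its size, and the window's bits
(negative-side support for crux `stmt-PneNP-16923`,
`PrimalityPlaces.ResolutionCannotProvePrimality`)

Third of four files.  `cornerL n` concatenates the row blocks of `CornerPrimesRows`;
`cornerL_stepList` shows it is a `StepList` over the axioms of `bal n p` whenever the bits
`n-1, …, 2n-3` and `2n-1` of `p` vanish and bit `0` is set, whence `exists_isResRefutation`: a
resolution refutation of `bal n p` with `≤ 4 · |cornerL n|` lines, and `length_cornerL_le`: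
`|cornerL n| ≤ 65 n²`.  `testBit_high`: every `p` of the corner window
`[4^(n-1), 4^(n-1) + 2^(n-1))` has those bits zero.  `eventually_lt_two_rpow`: `K n² < 2^(n^ε)`
for large `n`.  `CornerPrimesIO` (an `@[conjecture]` leaf, never asserted): the open,
Oppermann/Cramér-type hypothesis that the corner window contains a prime for infinitely many `n`;
the conditional refutation `ResolutionCannotProvePrimality_false_of_CornerPrimesIO` is the fourth
file `CornerPrimes`.
-/

set_option linter.dupNamespace false -- `Summit.PneNP.PneNP.…`: summit = sub-problem (D-0017)

open Literature.Computability.Complexity Literature.Computability.MetaComplexity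

namespace Summit.PneNP.PneNP.Theorems.ResolutionCannotProvePrimality.Negative

/-! ### The whole step list -/

section whole
variable {n p : ℕ}

/-- the clauses of the corner refutation, in derivation order. -/
def cornerL (n : ℕ) : List (Finset (Literal ℕ)) :=
  topRowL n ++ (List.range (n - 3)).flatMap (fun q => midRowL n (n - 2 - q)) ++ row1L n ++ finalL n

/-- the corner step list contains the empty clause. -/
theorem empty_mem_cornerL : (∅ : Finset (Literal ℕ)) ∈ cornerL n := by
  simp [cornerL, finalL]

/-- **The corner step list is a step list over the axioms of `bal n p`.** -/
theorem cornerL_stepList (hn : 3 ≤ n)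
    (hbits : ∀ j, n - 1 ≤ j → j ≠ 2 * n - 2 → Nat.testBit p j = false)
    (hbit0 : Nat.testBit p 0 = true) : StepList (clauseSet (bal n p)) (cornerL n) := by
  have hax : ∀ cl ∈ bal n p, cl.toFinset ∈ clauseSet (bal n p) := fun cl h => ax h
  unfold cornerL
  refine StepList.append (StepList.append (StepList.append
    (topRowL_stepList hn hbits hax) ?_) ?_) ?_
  · -- middle rows
    refine stepList_flatMap_range fun q hq => ?_
    refine midRowL_stepList (r := n - 2 - q) (by omega) (by omega)
      (fun cl h => Or.inl (Or.inl (hax cl h))) (fun i hi => ?_) ?_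
    · rcases Nat.eq_zero_or_pos q with rfl | hq1
      · have e : SV n (n - 1 - 1) (n - 1 - 1 + (n - 1 - (i + 1 - 1))) =
            SV n (n - 2 - 0) (n - 2 - 0 + (n - 1 - i)) := congrArg₂ (SV n) (by omega) (by omega)
        exact Or.inl (Or.inr (e ▸ mem_topRowL_sum (i := i + 1) (by omega) (by omega)))
      · have e : SV n (n - 2 - (q - 1) - 1) (n - 2 - (q - 1) - 1 + (n - 1 - (i + 1 - 1))) =
            SV n (n - 2 - q) (n - 2 - q + (n - 1 - i)) := congrArg₂ (SV n) (by omega) (by omega)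
        refine Or.inr ⟨q - 1, by omega, ?_⟩
        exact e ▸ mem_midRowL_sum (r := n - 2 - (q - 1)) (i := i + 1) (by omega) (by omega)
    · rcases Nat.eq_zero_or_pos q with rfl | hq1
      · have e : CV n (n - 1 - 1) (n - 1 + 1) = CV n (n - 2 - 0) (n - 1 + 1) :=
          congrArg₂ (CV n) (by omega) rfl
        exact Or.inl (Or.inr (e ▸ mem_topRowL_carry (by omega)))
      · have e : CV n (n - 2 - (q - 1) - 1) (n - 1 + 1) = CV n (n - 2 - q) (n - 1 + 1) :=
          congrArg₂ (CV n) (by omega) rfl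
        refine Or.inr ⟨q - 1, by omega, ?_⟩
        exact e ▸ mem_midRowL_carry (r := n - 2 - (q - 1))
  · -- row 1: its inputs come from row 2 = the top row (n = 3) or the last middle row (n ≥ 4)
    have hax' : ∀ cl ∈ bal n p, cl.toFinset ∈ clauseSet (bal n p) ∪
        {C | C ∈ topRowL n ++ (List.range (n - 3)).flatMap fun q => midRowL n (n - 2 - q)} :=
      fun cl h => Or.inl (hax cl h)
    have htop : ∀ C, C ∈ topRowL n → C ∈ clauseSet (bal n p) ∪
        {C | C ∈ topRowL n ++ (List.range (n - 3)).flatMap fun q => midRowL n (n - 2 - q)} :=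
      fun C hC => Or.inr (List.mem_append.2 (Or.inl hC))
    rcases Nat.lt_or_ge n 4 with h3 | h4
    · refine row1L_stepList hn hax' ?_ ?_ ?_
      · have e : SV n (n - 1 - 1) (n - 1 - 1 + (n - 1 - (1 - 1))) = SV n 1 (1 + (n - 1)) :=
          congrArg₂ (SV n) (by omega) (by omega)
        exact htop _ (e ▸ mem_topRowL_sum (i := 1) le_rfl (by omega))
      · have e : SV n (n - 1 - 1) (n - 1 - 1 + (n - 1 - (2 - 1))) = SV n 1 (1 + (n - 2)) :=
          congrArg₂ (SV n) (by omega) (by omega)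
        exact htop _ (e ▸ mem_topRowL_sum (i := 2) (by omega) (by omega))
      · have e : CV n (n - 1 - 1) (n - 1 + 1) = CV n 1 (n - 1 + 1) :=
          congrArg₂ (CV n) (by omega) rfl
        exact htop _ (e ▸ mem_topRowL_carry (by omega))
    · have hmid : ∀ C, C ∈ midRowL n (n - 2 - (n - 4)) → C ∈ clauseSet (bal n p) ∪
          {C | C ∈ topRowL n ++ (List.range (n - 3)).flatMap fun q => midRowL n (n - 2 - q)} :=
        fun C hC => Or.inr (List.mem_append.2 (Or.inr
          (List.mem_flatMap.2 ⟨n - 4, List.mem_range.2 (by omega), hC⟩)))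
      refine row1L_stepList hn hax' ?_ ?_ ?_
      · have e : SV n (n - 2 - (n - 4) - 1) (n - 2 - (n - 4) - 1 + (n - 1 - (1 - 1))) =
            SV n 1 (1 + (n - 1)) := congrArg₂ (SV n) (by omega) (by omega)
        exact hmid _ (e ▸ mem_midRowL_sum (r := n - 2 - (n - 4)) (i := 1) le_rfl (by omega))
      · have e : SV n (n - 2 - (n - 4) - 1) (n - 2 - (n - 4) - 1 + (n - 1 - (2 - 1))) =
            SV n 1 (1 + (n - 2)) := congrArg₂ (SV n) (by omega) (by omega)
        exact hmid _ (e ▸ mem_midRowL_sum (r := n - 2 - (n - 4)) (i := 2) (by omega) (by omega))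
      · have e : CV n (n - 2 - (n - 4) - 1) (n - 1 + 1) = CV n 1 (n - 1 + 1) :=
          congrArg₂ (CV n) (by omega) rfl
        exact hmid _ (e ▸ mem_midRowL_carry (r := n - 2 - (n - 4)))
  · -- final
    refine finalL_stepList (by omega) hbit0 (fun cl h => Or.inl (hax cl h)) ?_
    exact Or.inr (List.mem_append.2 (Or.inr mem_row1L_pp))

/-- **The corner refutation.** For `n ≥ 3` and `p` with bits `n-1 … 2n-3` and `2n-1` equal to `0`
and bit `0` equal to `1`, `bal n p` has a resolution refutation with at most `4 · |cornerL n|`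
lines. -/
theorem exists_isResRefutation (hn : 3 ≤ n)
    (hbits : ∀ j, n - 1 ≤ j → j ≠ 2 * n - 2 → Nat.testBit p j = false)
    (hbit0 : Nat.testBit p 0 = true) :
    ∃ π : List (ResLine ℕ), IsResRefutation (bal n p) π ∧ π.length ≤ 4 * (cornerL n).length := by
  obtain ⟨π, hπ, hlen, hall⟩ := (cornerL_stepList hn hbits hbit0).exists_isResDerivation
  obtain ⟨l, hl, hl0⟩ := hall ∅ empty_mem_cornerL
  exact ⟨π, ⟨hπ, l, hl, hl0⟩, hlen⟩

end whole

/-! ### Size of the step list -/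

section size
variable {n : ℕ}

/-- length of a `flatMap` with blocks of bounded length. -/
theorem length_flatMap_le {α : Type*} (l : List ℕ) (f : ℕ → List α) (B : ℕ)
    (h : ∀ x ∈ l, (f x).length ≤ B) : (l.flatMap f).length ≤ l.length * B := by
  induction l with
  | nil => simp
  | cons a l ih =>
    rw [List.flatMap_cons, List.length_append, List.length_cons]
    have h1 := h a (by simp)
    have h2 := ih (fun x hx => h x (List.mem_cons_of_mem _ hx))
    calc (f a).length + (l.flatMap f).length ≤ B + l.length * B := add_le_add h1 h2
      _ = (l.length + 1) * B := by ring

/-- a top-row block has at most `15` clauses. -/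
theorem length_topBlock_le (n i : ℕ) : (topBlock n i).length ≤ 15 := by
  unfold topBlock; split_ifs <;> simp [topCellL, cellL]

/-- the top row has at most `2 + 15 n` clauses. -/
theorem length_topRowL_le (n : ℕ) : (topRowL n).length ≤ 2 + n * 15 := by
  have := length_flatMap_le (List.range n) (topBlock n) 15 (fun i _ => length_topBlock_le n i)
  rw [List.length_range] at this
  simp only [topRowL, List.length_append, preL, List.length_cons, List.length_nil]
  omega

/-- a middle row `r` has at most `14 (r+1)` clauses. -/
theorem length_midRowL_le (n r : ℕ) : (midRowL n r).length ≤ (r + 1) * 14 := by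
  have := length_flatMap_le (List.range (r + 1)) (midBlock n r) 14
    (fun i _ => by simp [midBlock, cellL])
  rwa [List.length_range] at this

/-- **the corner step list has at most `65 n²` clauses.** -/
theorem length_cornerL_le (hn : 3 ≤ n) : (cornerL n).length ≤ 65 * n ^ 2 := by
  have h1 := length_topRowL_le n
  have h2 : ((List.range (n - 3)).flatMap fun q => midRowL n (n - 2 - q)).length ≤
      (n - 3) * (n * 14) := by
    have := length_flatMap_le (List.range (n - 3)) (fun q => midRowL n (n - 2 - q)) (n * 14)
      (fun q hq => ?_)
    · rwa [List.length_range] at this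
    · have hq' := List.mem_range.1 hq
      calc (midRowL n (n - 2 - q)).length ≤ (n - 2 - q + 1) * 14 := length_midRowL_le n _
        _ ≤ n * 14 := Nat.mul_le_mul_right _ (by omega)
  have h3 : (row1L n).length = 28 := by simp [row1L, cellL]
  have h4 : (finalL n).length = 5 := by simp [finalL]
  simp only [cornerL, List.length_append, h3, h4]
  have h5 : (n - 3) * (n * 14) ≤ n * (n * 14) := Nat.mul_le_mul_right _ (by omega)
  have h6 : n * 3 ≤ n * n := Nat.mul_le_mul_left _ hn
  nlinarith [h1, h2, h5, h6]

end size

/-! ### The window `[4^(n-1), 4^(n-1) + 2^(n-1))`: bits of `p` -/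

/-- In the corner window, the bits `n-1 … 2n-3` of `p` and all bits `≥ 2n-1` vanish. -/
theorem testBit_high {n p j : ℕ} (hn : 1 ≤ n) (hlo : 4 ^ (n - 1) ≤ p)
    (hhi : p < 4 ^ (n - 1) + 2 ^ (n - 1)) (hj : n - 1 ≤ j) (hj2 : j ≠ 2 * n - 2) :
    Nat.testBit p j = false := by
  have h4 : (4 : ℕ) ^ (n - 1) = 2 ^ (2 * n - 2) := by
    rw [show (4 : ℕ) = 2 ^ 2 by norm_num, ← pow_mul]; congr 1; omega
  rw [h4] at hlo hhi
  obtain ⟨c, rfl⟩ := Nat.exists_eq_add_of_le hlo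
  have hc : c < 2 ^ (n - 1) := by omega
  rcases lt_or_gt_of_ne hj2 with hlt | hgt
  · rw [Nat.testBit_two_pow_add_gt hlt]
    exact Nat.testBit_lt_two_pow (lt_of_lt_of_le hc (Nat.pow_le_pow_right (by norm_num) hj))
  · apply Nat.testBit_lt_two_pow
    calc 2 ^ (2 * n - 2) + c < 2 ^ (2 * n - 2) + 2 ^ (2 * n - 2) :=
          Nat.add_lt_add_left (lt_of_lt_of_le hc (Nat.pow_le_pow_right (by norm_num) (by omega))) _
      _ = 2 ^ (2 * n - 2 + 1) := by rw [← two_mul, ← pow_succ']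
      _ ≤ 2 ^ j := Nat.pow_le_pow_right (by norm_num) (by omega)

/-! ### `K · n² < 2^(n^ε)` eventually -/

/-- `K n² < 2^(n^ε)` for all large `n` (`log x = o(x^ε)`). -/
theorem eventually_lt_two_rpow (K : ℕ) {ε : ℝ} (hε : 0 < ε) :
    ∃ N : ℕ, ∀ n : ℕ, N ≤ n → (K : ℝ) * (n : ℝ) ^ 2 < (2 : ℝ) ^ ((n : ℝ) ^ ε) := by
  have hlog2 : (0 : ℝ) < Real.log 2 := Real.log_pos (by norm_num)
  have hc : (0 : ℝ) < Real.log 2 / 4 := by positivity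
  obtain ⟨a, ha⟩ := Filter.eventually_atTop.1 ((isLittleO_log_rpow_atTop hε).def hc)
  refine ⟨max (Nat.ceil a) (max K 1), fun n hn => ?_⟩
  have hK1 : max K 1 ≤ n := (le_max_right _ _).trans hn
  have hn1 : (1 : ℝ) ≤ n := by exact_mod_cast (le_max_right K 1).trans hK1
  have hnK : (K : ℝ) ≤ n := by exact_mod_cast (le_max_left K 1).trans hK1
  have hna : a ≤ (n : ℝ) :=
    (Nat.le_ceil a).trans (by exact_mod_cast (le_max_left _ _).trans hn)
  have hlog := ha n hna
  have hn0 : (0 : ℝ) < n := by linarith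
  have hrpow_pos : (0 : ℝ) < (n : ℝ) ^ ε := Real.rpow_pos_of_pos hn0 ε
  have hrpow1 : (1 : ℝ) ≤ (n : ℝ) ^ ε := Real.one_le_rpow hn1 hε.le
  rw [Real.norm_eq_abs, Real.norm_eq_abs, abs_of_nonneg (Real.log_nonneg hn1),
    abs_of_pos hrpow_pos] at hlog
  have h1 : (K : ℝ) * (n : ℝ) ^ 2 ≤ (n : ℝ) ^ 3 := by nlinarith
  rcases Nat.eq_zero_or_pos K with rfl | hK
  · simp only [Nat.cast_zero, zero_mul]
    positivity
  · have hpos : (0 : ℝ) < (K : ℝ) * (n : ℝ) ^ 2 := by positivity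
    have h2 : Real.log ((K : ℝ) * (n : ℝ) ^ 2) ≤ 3 * Real.log n := by
      calc Real.log ((K : ℝ) * (n : ℝ) ^ 2) ≤ Real.log ((n : ℝ) ^ 3) := Real.log_le_log hpos h1
        _ = 3 * Real.log n := by rw [Real.log_pow]; norm_num
    have h3 : 3 * Real.log n < Real.log 2 * (n : ℝ) ^ ε := by nlinarith
    calc (K : ℝ) * (n : ℝ) ^ 2 = Real.exp (Real.log ((K : ℝ) * (n : ℝ) ^ 2)) :=
          (Real.exp_log hpos).symm
      _ < Real.exp (Real.log 2 * (n : ℝ) ^ ε) := Real.exp_lt_exp.2 (by linarith)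
      _ = (2 : ℝ) ^ ((n : ℝ) ^ ε) := (Real.rpow_def_of_pos (by norm_num) _).symm

/-- OPEN CONJECTURE (hypothesis of the negative lemma, never asserted) — `CornerPrimesIO`:
**corner primes infinitely often.** For infinitely many `n` some prime `p` satisfies
`4^(n-1) ≤ p < 4^(n-1) + 2^(n-1)`, i.e. lies in `[m², m² + m)` with `m = 2^(n-1)`.  A consequence
of Oppermann's conjecture (1882) and of Cramér's conjecture `p_{k+1} - p_k = O(log² p_k)` as
stated in Crandall–Pomerance, *Prime Numbers: A Computational Perspective*, §1.4.1 (the least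
prime `≥ 4^(n-1)` is then within `O(n²) < 2^(n-1)`; numerically it lies in the window for every
`n ≤ 64`).  OPEN: unconditionally one only has primes in `[x - x^0.525, x]` for `x > x₀`
(Baker–Harman–Pintz, Proc. LMS 83 (2001), Thm. 1), and RH only bounds gaps by `O(√p log p)`
(Cramér 1920), a window `2^(n-1) · O(n)`.  Users take `(h : CornerPrimesIO)`.
[status: open] -/
@[conjecture] def CornerPrimesIO : Prop :=
  ∀ N : ℕ, ∃ n ≥ N, ∃ p : ℕ, p.Prime ∧ 4 ^ (n - 1) ≤ p ∧ p < 4 ^ (n - 1) + 2 ^ (n - 1)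

end Summit.PneNP.PneNP.Theorems.ResolutionCannotProvePrimality.Negative
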